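import Mathlib

/-!
# Roy 2010 — *Small value estimates for the additive group*: the main statements

Citation header.  D. Roy, *Small value estimates for the additive group*, Int. J. Number
Theory **6** (2010) 919–956; arXiv:0708.2307 (bib key `Roy2010`).  Typed from the arXiv text
(§1 Theorems 1.1–1.3, §3 Proposition 3.1 and Corollary 3.2, with the notation of §2 and
eq. (3.1)).  What is reproduced: STATEMENTS ONLY, as named facts (`def … : Prop`, D-0014);
users take `(h : thm_1_2)` etc. as a hypothesis.  Nothing here is proved except the two
lines of arithmetic in Roy's remark on the gaps to the box principle.  No claimed result is
under adjudication: all the statements typed are theorems in print.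

Typing conventions (each recorded again in the docstring it affects).
* Roy works with non-zero `P ∈ ℚ[T]`, the content `cont P ∈ ℚ_{>0}` and the projective
  height `H(P) = ‖P‖ / cont P` (§2), `‖P‖ = max |coefficient|`.  Every statement below is
  invariant under `P ↦ aP` (`a ∈ ℚˣ`) or only gets weaker when `H(P)` is replaced by the
  naive height `‖P‖` of an INTEGER polynomial (`H(P) ≤ ‖P‖`, `cont P ≥ 1` on `ℤ[T] ∖ 0`).
  We therefore type the statements for `P ∈ ℤ[X]` with Mathlib's `Polynomial.supNorm`
  (`= max ‖coeff‖`), and take every gcd as the primitive part (`Polynomial.primPart`) of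
  the normalised gcd in `ℤ[X]` (`Finset.gcd`; Mathlib's `NormalizedGCDMonoid ℤ[X]`), which
  is one of the `ℚ[T]`-gcds Roy's statements quantify over and has content `1`.  On
  primitive inputs the typed forms are the printed ones verbatim; on general integer
  inputs they are implied by the printed ones.
* `P^{[j]}` (the `j`-th divided derivative, §2) is `Polynomial.hasseDeriv j P`.
* "max over a finite box `> exp(-n^ν)`" is typed as "some entry `> exp(-n^ν)`"; a printed
  upper bound by a maximum (Prop. 3.1, Cor. 3.2) is typed in the equivalent BOUND FORM
  "for every `V` dominating the entries" (the right-hand sides are monotone in the entries).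
* "for infinitely many `n`" is `∃ᶠ n in atTop`; "if `n` is sufficiently large as a function
  of `β, δ, μ`" (Thm 1.2, uniform in `P`) is `∃ n₀, ∀ n ≥ n₀, ∀ P`.

Not typed here: Lemma 2.1 (linearisation, elementary), Lemma 2.2 (the Gel'fond–Brownawell
criterion Roy quotes from [Ph], [LR2], [Br1] — cf. the tree's
`Literature.NumberTheory.Transcendental.GelfondCriterion`), Theorem 7.1 (the general gcd
estimate behind Theorem 1.2), §§4–6, 8–13 and the appendices (box principle).

Consumer on the summit side: the node `royAdditiveSVEExponents ξ β σ τ`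
(`Summits/Schanuel/Schanuel/Theorems/SoloInformedRoyAdditiveDirichlet.lean`) is the
exponent set of Theorem 1.1 (3); Theorem 1.2 and Corollary 3.2 are the two inputs of Roy's
reduction step (dilate by primes, take a gcd, transfer smallness to the gcd pointwise).
-/

namespace Literature.NumberTheory.Transcendental.Roy2010

open Polynomial Finset Filter

/-! ## §1 — the data of Theorem 1.1 -/

/-- The standing data of [Roy2010, Thm 1.1]: a sequence `(P_n)_{n ≥ n₀}` of non-zero
integer polynomials with `deg P_n ≤ n` and height `≤ exp(n^β)`.  Printed with Roy's
projective height `H(P_n) = ‖P_n‖ / cont(P_n)`; typed with the naive height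
`‖P_n‖ = Polynomial.supNorm` — the resulting theorems are equivalent (pass to primitive
parts: the values `|P_n^{[j]}(z)|` only shrink, `H` is unchanged). [cite: Roy2010, Theorem 1.1] -/
def HeightData (β : ℝ) (P : ℕ → ℤ[X]) (n₀ : ℕ) : Prop :=
  ∀ n : ℕ, n₀ ≤ n → P n ≠ 0 ∧ (P n).natDegree ≤ n ∧ (P n).supNorm ≤ Real.exp ((n : ℝ) ^ β)

/-- **[Roy2010, Thm 1.1 (1)]** (rational translates of `ξ`).  `ξ` transcendental,
`r ∈ ℚ ∖ {0}`, `β > 1`, `σ + τ < 1`, `ν > 1 + β − σ − τ` (`σ, τ ≥ 0`): for every sequence as in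
`HeightData β P n₀`, for infinitely many `n`,
`max {|P_n^{[j]}(ξ + i r)| ; 0 ≤ i ≤ n^σ, 0 ≤ j ≤ n^τ} > exp(−n^ν)`.
Best possible in `ν` by the box principle (Roy, Appendix A).  Named fact (D-0014); users
take `(h : thm_1_1_part1)`. [cite: Roy2010, Theorem 1.1 (1)] -/
def thm_1_1_part1 : Prop :=
  ∀ (ξ : ℂ), Transcendental ℚ ξ → ∀ (r : ℚ), r ≠ 0 →
    ∀ (β σ τ ν : ℝ), 0 ≤ σ → 0 ≤ τ → 1 < β → σ + τ < 1 → 1 + β - σ - τ < ν →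
    ∀ (P : ℕ → ℤ[X]) (n₀ : ℕ), 0 < n₀ → HeightData β P n₀ →
    ∃ᶠ n : ℕ in atTop, ∃ i j : ℕ, (i : ℝ) ≤ (n : ℝ) ^ σ ∧ (j : ℝ) ≤ (n : ℝ) ^ τ ∧
      Real.exp (-(n : ℝ) ^ ν) < ‖aeval (ξ + (i : ℂ) * (r : ℂ)) (hasseDeriv j (P n))‖

/-- **[Roy2010, Thm 1.1 (2)]** (the one multiplicative statement: points `r^i ξ`).
`ξ` transcendental, `r ∈ ℚ_{>0}`, `r ≠ 1`, `β > 1 + σ`, `σ + τ < 1`, `ν > 1 + β − σ − τ`: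
for infinitely many `n`, `max {|P_n^{[j]}(r^i ξ)| ; 0 ≤ i ≤ n^σ, 0 ≤ j ≤ n^τ} > exp(−n^ν)`.
Named fact (D-0014). [cite: Roy2010, Theorem 1.1 (2)] -/
def thm_1_1_part2 : Prop :=
  ∀ (ξ : ℂ), Transcendental ℚ ξ → ∀ (r : ℚ), 0 < r → r ≠ 1 →
    ∀ (β σ τ ν : ℝ), 0 ≤ σ → 0 ≤ τ → 1 + σ < β → σ + τ < 1 → 1 + β - σ - τ < ν →
    ∀ (P : ℕ → ℤ[X]) (n₀ : ℕ), 0 < n₀ → HeightData β P n₀ →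
    ∃ᶠ n : ℕ in atTop, ∃ i j : ℕ, (i : ℝ) ≤ (n : ℝ) ^ σ ∧ (j : ℝ) ≤ (n : ℝ) ^ τ ∧
      Real.exp (-(n : ℝ) ^ ν) < ‖aeval ((r : ℂ) ^ i * ξ) (hasseDeriv j (P n))‖

/-- **[Roy2010, Thm 1.1 (3)] — the paper's main result** (multiples of `ξ`).
`ξ` transcendental, `β > 1`, `(3/4)σ + τ < 1`, `ν > 1 + β − (3/4)σ − τ` (`σ, τ ≥ 0`): for every
sequence as in `HeightData β P n₀`, for infinitely many `n`,
`max {|P_n^{[j]}(i ξ)| ; 0 ≤ i ≤ n^σ, 0 ≤ j ≤ n^τ} > exp(−n^ν)`.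
The box principle makes this false for `ν < 1 + β − σ − τ` (a gap of `σ/4`,
`thm_1_1_part3_gap`); whether every `ν > 1 + β − σ − τ` works is the open question the summit
node `royAdditiveSVEExponents` records.  Named fact (D-0014); users take
`(h : thm_1_1_part3)`. [cite: Roy2010, Theorem 1.1 (3)] -/
def thm_1_1_part3 : Prop :=
  ∀ (ξ : ℂ), Transcendental ℚ ξ →
    ∀ (β σ τ ν : ℝ), 0 ≤ σ → 0 ≤ τ → 1 < β → 3 / 4 * σ + τ < 1 →
    1 + β - 3 / 4 * σ - τ < ν →
    ∀ (P : ℕ → ℤ[X]) (n₀ : ℕ), 0 < n₀ → HeightData β P n₀ →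
    ∃ᶠ n : ℕ in atTop, ∃ i j : ℕ, (i : ℝ) ≤ (n : ℝ) ^ σ ∧ (j : ℝ) ≤ (n : ℝ) ^ τ ∧
      Real.exp (-(n : ℝ) ^ ν) < ‖aeval ((i : ℂ) * ξ) (hasseDeriv j (P n))‖

/-- **[Roy2010, Thm 1.1 (4)]** (points `i₁ ξ + i₂ r`, `r ∈ ℚ ∖ {0}`).  `ξ` transcendental,
`β > 1`, `(4/3)σ + τ < 1`, `ν > 1 + β − (4/3)σ − τ`: for infinitely many `n`,
`max {|P_n^{[j]}(i₁ ξ + i₂ r)| ; 0 ≤ i₁, i₂ ≤ n^σ, 0 ≤ j ≤ n^τ} > exp(−n^ν)`.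
Named fact (D-0014). [cite: Roy2010, Theorem 1.1 (4)] -/
def thm_1_1_part4 : Prop :=
  ∀ (ξ : ℂ), Transcendental ℚ ξ → ∀ (r : ℚ), r ≠ 0 →
    ∀ (β σ τ ν : ℝ), 0 ≤ σ → 0 ≤ τ → 1 < β → 4 / 3 * σ + τ < 1 →
    1 + β - 4 / 3 * σ - τ < ν →
    ∀ (P : ℕ → ℤ[X]) (n₀ : ℕ), 0 < n₀ → HeightData β P n₀ →
    ∃ᶠ n : ℕ in atTop, ∃ i₁ i₂ j : ℕ, (i₁ : ℝ) ≤ (n : ℝ) ^ σ ∧ (i₂ : ℝ) ≤ (n : ℝ) ^ σ ∧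
      (j : ℝ) ≤ (n : ℝ) ^ τ ∧
      Real.exp (-(n : ℝ) ^ ν) <
        ‖aeval ((i₁ : ℂ) * ξ + (i₂ : ℂ) * (r : ℂ)) (hasseDeriv j (P n))‖

/-- **[Roy2010, Thm 1.1 (5)]** (points `i₁ ξ + i₂ η`, `η` algebraic over `ℚ(ξ)` with
`η ∉ ℚ ξ`).  `ξ` transcendental, `β > 1`, `(3/2)σ + τ < 1`, `ν > 1 + β − σ − τ`: for infinitely
many `n`, `max {|P_n^{[j]}(i₁ ξ + i₂ η)| ; 0 ≤ i₁, i₂ ≤ n^σ, 0 ≤ j ≤ n^τ} > exp(−n^ν)`.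
(Proved in §8 in a more general form for subgroups of arbitrary rank, not typed.)
Named fact (D-0014). [cite: Roy2010, Theorem 1.1 (5)] -/
def thm_1_1_part5 : Prop :=
  ∀ (ξ : ℂ), Transcendental ℚ ξ → ∀ (η : ℂ),
    IsAlgebraic (IntermediateField.adjoin ℚ ({ξ} : Set ℂ)) η → (∀ q : ℚ, η ≠ (q : ℂ) * ξ) →
    ∀ (β σ τ ν : ℝ), 0 ≤ σ → 0 ≤ τ → 1 < β → 3 / 2 * σ + τ < 1 → 1 + β - σ - τ < ν →
    ∀ (P : ℕ → ℤ[X]) (n₀ : ℕ), 0 < n₀ → HeightData β P n₀ →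
    ∃ᶠ n : ℕ in atTop, ∃ i₁ i₂ j : ℕ, (i₁ : ℝ) ≤ (n : ℝ) ^ σ ∧ (i₂ : ℝ) ≤ (n : ℝ) ^ σ ∧
      (j : ℝ) ≤ (n : ℝ) ^ τ ∧
      Real.exp (-(n : ℝ) ^ ν) < ‖aeval ((i₁ : ℂ) * ξ + (i₂ : ℂ) * η) (hasseDeriv j (P n))‖

/-- **[Roy2010, Thm 1.1 (6)]** (an arbitrary translate, no derivatives).  `ξ` transcendental,
`η ∈ ℂ`, `β > 1`, `σ < 1`, `ν > 3 + β − (11/4)σ` (`σ ≥ 0`): for every sequence as in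
`HeightData β P n₀`, for infinitely many `n`, `max {|P_n(i ξ + η)| ; 0 ≤ i ≤ n^σ} > exp(−n^ν)`
(a gap of `2 − (7/4)σ` to the box principle; proved in §11 from (3) by eliminating `η`
through a resultant).  Named fact (D-0014). [cite: Roy2010, Theorem 1.1 (6)] -/
def thm_1_1_part6 : Prop :=
  ∀ (ξ : ℂ), Transcendental ℚ ξ → ∀ (η : ℂ),
    ∀ (β σ ν : ℝ), 0 ≤ σ → 1 < β → σ < 1 → 3 + β - 11 / 4 * σ < ν →
    ∀ (P : ℕ → ℤ[X]) (n₀ : ℕ), 0 < n₀ → HeightData β P n₀ →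
    ∃ᶠ n : ℕ in atTop, ∃ i : ℕ, (i : ℝ) ≤ (n : ℝ) ^ σ ∧
      Real.exp (-(n : ℝ) ^ ν) < ‖aeval ((i : ℂ) * ξ + η) (P n)‖

/-- Roy's remark after Thm 1.1 (§1, p. 2 of the arXiv text): statement (3) "shows a gap of
`σ/4`" to the box-principle threshold `1 + β − σ − τ` — the arithmetic of that remark.
[cite: Roy2010, §1, remark following Theorem 1.1] -/
theorem thm_1_1_part3_gap (β σ τ : ℝ) :
    (1 + β - 3 / 4 * σ - τ) - (1 + β - σ - τ) = σ / 4 := by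
  ring

/-- The same remark: statement (6) shows "a gap of `2 − (7/4)σ`" to the box principle
(threshold `1 + β − σ` at `τ = 0`) — the arithmetic of that remark.
[cite: Roy2010, §1, remark following Theorem 1.1] -/
theorem thm_1_1_part6_gap (β σ : ℝ) :
    (3 + β - 11 / 4 * σ) - (1 + β - σ) = 2 - 7 / 4 * σ := by
  ring

/-! ## §1 — Theorem 1.2 (the dilation-gcd estimate) and Theorem 1.3 -/

/-- The set `A` of [Roy2010, Thm 1.2] / `A_n` of Thm 1.3: all primes `p ≤ x` (`x = n^μ`).
[cite: Roy2010, Theorem 1.2] -/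
noncomputable def primesLe (x : ℝ) : Finset ℕ :=
  (Finset.Iic ⌊x⌋₊).filter Nat.Prime

/-- The set `B_n` of [Roy2010, Thm 1.3]: all primes `p` with `x < p ≤ y` (`x = n^μ`,
`y = n^{2μ}`). [cite: Roy2010, Theorem 1.3] -/
noncomputable def primesIoc (x y : ℝ) : Finset ℕ :=
  (Finset.Ioc ⌊x⌋₊ ⌊y⌋₊).filter Nat.Prime

/-- The dilation-gcd of [Roy2010, Thm 1.2]: `Q = gcd {P(aT) ; a ∈ A}`, taken as the primitive
part of the normalised gcd in `ℤ[X]` (one of the `ℚ[T]`-gcds of the printed statement; it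
has content `1`, so its Roy height is its naive height). [cite: Roy2010, Theorem 1.2] -/
noncomputable def dilationGcd (A : Finset ℕ) (P : ℤ[X]) : ℤ[X] :=
  (A.gcd fun a : ℕ => P.comp (C (a : ℤ) * X)).primPart

/-- **[Roy2010, Thm 1.2]** (gcd of prime dilates; proved in §7 from Theorem 7.1).  Let
`0 < μ < 1 < β`, `δ > 0`, `A` = the primes `p ≤ n^μ`, `P ∈ ℚ[T]` non-zero of degree `≤ n` and
height `≤ exp(n^β)` with `P(0) ≠ 0`, `Q = gcd {P(aT) ; a ∈ A}`.  If `n` is sufficiently large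
as a function of `β, δ, μ` (uniformly in `P`), then `deg Q ≤ n^{1−μ+δ}` and
`H(Q) ≤ exp(n^{β−μ+δ})`.  Typed for `P ∈ ℤ[X]` with naive height (`H(P) ≤ ‖P‖`, so the typed
hypothesis implies the printed one) and `Q = dilationGcd A P` (primitive: `H(Q) = ‖Q‖`).
Named fact (D-0014); users take `(h : thm_1_2)`. [cite: Roy2010, Theorem 1.2] -/
def thm_1_2 : Prop :=
  ∀ (β δ μ : ℝ), 0 < δ → 0 < μ → μ < 1 → 1 < β →
    ∃ n₀ : ℕ, ∀ n : ℕ, n₀ ≤ n → ∀ P : ℤ[X], P ≠ 0 → P.natDegree ≤ n →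
      P.supNorm ≤ Real.exp ((n : ℝ) ^ β) → P.coeff 0 ≠ 0 →
      ((dilationGcd (primesLe ((n : ℝ) ^ μ)) P).natDegree : ℝ) ≤ (n : ℝ) ^ (1 - μ + δ) ∧
        (dilationGcd (primesLe ((n : ℝ) ^ μ)) P).supNorm ≤ Real.exp ((n : ℝ) ^ (β - μ + δ))

/-- **[Roy2010, Thm 1.3]** (values at products of two primes times `ξ`; proved in §10 via
Gel'fond's criterion, so `ξ` is the transcendental number of Thm 1.1).  Let
`0 < 2μ < α < β`, `δ > 0`, `A_n` = primes `≤ n^μ`, `B_n` = primes in `(n^μ, n^{2μ}]`.  For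
infinitely many `n` there is NO non-zero `P ∈ ℤ[T]` of degree `≤ n^α` and height
`≤ exp(n^β)` with `∏_{a ∈ A_n} ∏_{b ∈ B_n} |P(abξ)| ≤ exp(−n^{α+β+2μ+δ})` (naive height typed;
equivalent to the printed projective height by passing to primitive parts).
Named fact (D-0014); users take `(h : thm_1_3)`. [cite: Roy2010, Theorem 1.3] -/
def thm_1_3 : Prop :=
  ∀ (ξ : ℂ), Transcendental ℚ ξ → ∀ (α β δ μ : ℝ), 0 < α → 0 < δ → 0 < μ →
    2 * μ < α → α < β →
    ∃ᶠ n : ℕ in atTop, ¬ ∃ P : ℤ[X], P ≠ 0 ∧ (P.natDegree : ℝ) ≤ (n : ℝ) ^ α ∧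
      P.supNorm ≤ Real.exp ((n : ℝ) ^ β) ∧
      ∏ a ∈ primesLe ((n : ℝ) ^ μ), ∏ b ∈ primesIoc ((n : ℝ) ^ μ) ((n : ℝ) ^ (2 * μ)),
          ‖aeval (((a * b : ℕ) : ℂ) * ξ) P‖ ≤
        Real.exp (-(n : ℝ) ^ (α + β + 2 * μ + δ))

/-! ## §3 — resultant estimates: Proposition 3.1 and Corollary 3.2 -/

/-- `c_E = max_{ξ ∈ E} |ξ|` of [Roy2010, Prop 3.1] (`0` for `E = ∅`).
[cite: Roy2010, Proposition 3.1] -/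
noncomputable def cMax (E : Finset ℂ) : ℝ :=
  ((E.sup fun z => ‖z‖₊ : NNReal) : ℝ)

/-- `Δ_E = ∏_{ξ' ≠ ξ} |ξ' − ξ|^{1/2}` over ORDERED pairs of distinct elements of `E`
([Roy2010, eq. (3.1)]); `Δ_E = 1` when `|E| ≤ 1` (empty product), as printed.
[cite: Roy2010, §3 eq. (3.1)] -/
noncomputable def deltaCap (E : Finset ℂ) : ℝ :=
  ∏ p ∈ E.offDiag, Real.sqrt ‖p.1 - p.2‖

/-- The constant `c₁ = e^{7n²} (2 + c_E)^{4nst} Δ_E^{−t²}` of [Roy2010, Prop 3.1].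
[cite: Roy2010, Proposition 3.1] -/
noncomputable def c₁ (n s t : ℕ) (E : Finset ℂ) : ℝ :=
  Real.exp (7 * (n : ℝ) ^ 2) * (2 + cMax E) ^ (4 * n * s * t) / deltaCap E ^ (t ^ 2)

/-- **[Roy2010, Prop 3.1]** (two polynomials).  `n, s, t ≥ 1`, `n ≥ st`, `E` a set of `s`
complex numbers, `F, G ∈ ℚ[T]` non-zero of degree `≤ n`, `Q = gcd(F, G)`; for integers `f, g`
with `deg(F/Q) ≤ f ≤ n`, `deg(G/Q) ≤ g ≤ n`:
`H(Q)^{f+g} ∏_{ξ∈E} (|Q(ξ)|/‖Q‖)^t ≤ c₁ H(F)^g H(G)^f ∏_{ξ∈E} max_{0≤j<t} max(|F^{[j]}(ξ)|/‖F‖,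
|G^{[j]}(ξ)|/‖G‖)^t`.  Typed after Roy's own normalisation (first line of his proof: both
sides are invariant under `ℚˣ`-scaling of `F`, `G`, `Q` separately): `F, G` PRIMITIVE in `ℤ[X]`
(so `H = ‖·‖ = supNorm`), `Q` = the normalised gcd in `ℤ[X]` (primitive, `H(Q) = ‖Q‖`), and
the maximum in BOUND FORM (`V ξ` any common upper bound of the `2t` quotients; the right side
is monotone).  Named fact (D-0014); users take `(h : prop_3_1)`. [cite: Roy2010, Proposition 3.1] -/
def prop_3_1 : Prop :=
  ∀ (n s t : ℕ), 0 < n → 0 < s → 0 < t → s * t ≤ n → ∀ (E : Finset ℂ), E.card = s →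
    ∀ (F G : ℤ[X]), F ≠ 0 → G ≠ 0 → F.IsPrimitive → G.IsPrimitive →
    F.natDegree ≤ n → G.natDegree ≤ n →
    ∀ (f g : ℕ), F.natDegree - (gcd F G).natDegree ≤ f → f ≤ n →
    G.natDegree - (gcd F G).natDegree ≤ g → g ≤ n →
    ∀ (V : ℂ → ℝ), (∀ z ∈ E, ∀ j : ℕ, j < t →
      ‖aeval z (hasseDeriv j F)‖ / F.supNorm ≤ V z ∧
        ‖aeval z (hasseDeriv j G)‖ / G.supNorm ≤ V z) →
    (gcd F G).supNorm ^ (f + g) * ∏ z ∈ E, (‖aeval z (gcd F G)‖ / (gcd F G).supNorm) ^ t ≤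
      c₁ n s t E * F.supNorm ^ g * G.supNorm ^ f * ∏ z ∈ E, V z ^ t

/-- **[Roy2010, Cor 3.2]** (a family).  `n, s, t ≥ 1` with `n ≥ st`, `E` a set of `s` complex
numbers, `P_1, …, P_r ∈ ℚ[T]` (`r ≥ 2`) non-zero of degree `≤ n`, `Q` their gcd:
`∏_{ξ∈E} (|Q(ξ)| / cont Q)^t ≤ e^{3n²} c₁ (max_i H(P_i))^{2n} ∏_{ξ∈E} (max_{i, 0≤j<t}
|P_i^{[j]}(ξ)| / cont P_i)^t`.  Typed for INTEGER `P_i` (not necessarily primitive) with `Q`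
the primitive part of their normalised gcd in `ℤ[X]` (`cont Q = 1`) and in BOUND FORM: `H`
any bound of the naive heights `‖P_i‖ ≥ H(P_i)`, `V ξ` any bound of the values
`|P_i^{[j]}(ξ)| ≥ |P_i^{[j]}(ξ)| / cont P_i`; since the printed right side is monotone in these
quantities, the printed statement implies the typed one, and on primitive `P_i` with `H`, `V`
the maxima they coincide.  Named fact (D-0014); users take `(h : cor_3_2)`.
[cite: Roy2010, Corollary 3.2] -/
def cor_3_2 : Prop :=
  ∀ (n s t : ℕ), 0 < n → 0 < s → 0 < t → s * t ≤ n → ∀ (E : Finset ℂ), E.card = s →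
    ∀ (r : ℕ), 2 ≤ r → ∀ (P : Fin r → ℤ[X]), (∀ i, P i ≠ 0) → (∀ i, (P i).natDegree ≤ n) →
    ∀ (H : ℝ), (∀ i, (P i).supNorm ≤ H) →
    ∀ (V : ℂ → ℝ), (∀ z ∈ E, ∀ i, ∀ j : ℕ, j < t → ‖aeval z (hasseDeriv j (P i))‖ ≤ V z) →
    ∏ z ∈ E, ‖aeval z ((Finset.univ : Finset (Fin r)).gcd P).primPart‖ ^ t ≤
      Real.exp (3 * (n : ℝ) ^ 2) * c₁ n s t E * H ^ (2 * n) * ∏ z ∈ E, V z ^ t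

end Literature.NumberTheory.Transcendental.Roy2010
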